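import Summits.AtomisticToContinuum.BoseEinsteinCondensation.Theorems.BECBathMassLiouvilleFrozenBathNoBECLocal
import Summits.AtomisticToContinuum.BoseEinsteinCondensation.Theorems.BECBathMassLiouvilleFrozenBathNoBECBracketing
import Literature.MathematicalPhysics.QuantumManyBody.LiebYngvasonDyson
import Literature.MathematicalPhysics.QuantumManyBody.PeriodicBoseGasImpurityTranslation
import Literature.MathematicalPhysics.QuantumManyBody.CoarseModeRayPOVMOneParticle
import Literature.MathematicalPhysics.QuantumManyBody.PeriodicBoseGasThm31
import Literature.MathematicalPhysics.QuantumManyBody.DiluteBoseGasUpperBoundLocalization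
import HarnessLib

/-!
# Route BECBathMassLiouville — `FrozenBathNoBEC` (stmt-AtomisticToContinuum-13803), helper file 3:
# from one-body periodic trial states to functions on `ℝ³`, and "good configurations are not bad"

The item speaks of `φ : PeriodicTrialState 1 L` (wave functions on `Config 1 = Fin 1 → ℝ³`), its
quenched energy `∫_{cell¹} (|∇φ|² + ∑ⱼ v^per(x₀ - Yⱼ)|φ|²)` and its constant-mode occupation
`condensateOccupation 1 L φ`. Writing `f(x) = φ(x)` (`x ↦ (fun _ => x)`), these are
`∫_{[0,L)³} (|∇f|² + V_Y |f|²)` and `L⁻³ |∫_{[0,L)³} f|²` with `∫_{[0,L)³}|f|² = 1`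
(`lintegral_quenched_eq`, `condensateOccupation_one_eq`, `lintegral_normSq_eq_one`).

With helper files 1–2 this gives the deterministic half of the item (`not_bad_of_good`): if the
sub-cells `q ∈ O` of `[0,L)³ = [0,kℓ)³` each contain a scatterer `Yⱼ` together with its range ball,
`#Oᶜ ≤ εk³/4`, the quenched ground-state energy is `≤ η` and `32ℓ³η ≤ W₀(K)ε`
(`W₀(K) = ∫ min(v(|z|),K)dz`, `K ≤ 2π²/(3ℓ²)`), then it is NOT true that at every precision `δ` there
is a `δ`-near-ground state with constant-mode weight `> ε` (take `δ = η`).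
-/

noncomputable section

namespace Summit.AtomisticToContinuum.BoseEinsteinCondensation.Theorems.FrozenBath

open MeasureTheory Metric Set Filter
open scoped ENNReal NNReal
open Literature.MathematicalPhysics.QuantumManyBody.BoseGas

variable {L : ℝ}

/-- The one-body function `x ↦ φ(x)` of a one-particle periodic trial state is `C¹`. [folklore] -/
theorem contDiff_oneBody (φ : PeriodicTrialState 1 L) :
    ContDiff ℝ 1 fun x : Space => φ.ψ fun _ => x :=
  φ.contDiff.comp (contDiff_pi.2 fun _ => contDiff_id)

/-- **Normalisation on the cell**: `∫_{[0,L)³} |φ(x)|² dx = 1`. [folklore] -/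
theorem lintegral_normSq_eq_one (φ : PeriodicTrialState 1 L) :
    ∫⁻ x in cell L, (‖φ.ψ fun _ => x‖₊ : ℝ≥0∞) ^ 2 = 1 := by
  rw [← lintegral_cellN_one L fun x => (‖φ.ψ fun _ => x‖₊ : ℝ≥0∞) ^ 2, ← φ.norm_eq]
  refine lintegral_congr fun X => ?_
  rw [← config_one_eq X]

/-- **The quenched energy through the one-body function**:
`∫_{cell¹} (|∇φ|² + V(x₀)|φ|²) = ∫_{[0,L)³} (|∇f|² + V|f|²)`, `f(x) = φ(x)`. [folklore] -/
theorem lintegral_quenched_eq (φ : PeriodicTrialState 1 L) (V : Space → ℝ≥0∞) :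
    ∫⁻ X in cellN 1 L, (kineticDensity φ.ψ X + V (X 0) * (‖φ.ψ X‖₊ : ℝ≥0∞) ^ 2) =
      ∫⁻ x in cell L, (gradSqC (fun y : Space => φ.ψ fun _ => y) x +
        V x * (‖φ.ψ fun _ => x‖₊ : ℝ≥0∞) ^ 2) := by
  have hdiff : Differentiable ℝ φ.ψ := φ.contDiff.differentiable one_ne_zero
  rw [← lintegral_cellN_one L fun x => gradSqC (fun y : Space => φ.ψ fun _ => y) x +
    V x * (‖φ.ψ fun _ => x‖₊ : ℝ≥0∞) ^ 2]
  refine lintegral_congr fun X => ?_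
  rw [Dyson.gradSqC_comp_const hdiff, ← config_one_eq X]

/-- **The constant-mode occupation of a one-particle state**: `n₀(φ) = L⁻³ |∫_{[0,L)³} φ(x) dx|²`.
[cite: Fournais2020, (1.3)–(1.4)] -/
theorem condensateOccupation_one_eq (hL : 0 < L) (φ : PeriodicTrialState 1 L) :
    condensateOccupation 1 L φ.ψ =
      (ENNReal.ofReal L ^ 3)⁻¹ * (‖∫ x in cell L, φ.ψ fun _ => x‖₊ : ℝ≥0∞) ^ 2 := by
  have h := condensateOccupation_succ (n := 0) hL φ.ψ
  simp only [Nat.cast_zero, zero_add, one_mul] at h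
  rw [h]
  congr 1
  have hcell : cellN 0 L = univ := eq_univ_of_forall fun _ i => i.elim0
  have hvol : (volume : Measure (Config 0)) = Measure.dirac default := by
    rw [volume_pi, Measure.pi_of_empty _ default]
  rw [hcell, Measure.restrict_univ, hvol, lintegral_dirac]
  simp only [Matrix.cons_fin_one]

/-- A single scatterer's truncated potential is below the full quenched potential:
`min(v(|x - Yⱼ|), K) ≤ ∑ⱼ' v^per(x - Yⱼ')`. [folklore] -/
theorem min_le_quenched (v : ℝ → ℝ≥0∞) (L : ℝ) (K : ℝ≥0∞) {M : ℕ} (Y : Config M) (j : Fin M)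
    (x : Space) : min (v ‖x - Y j‖) K ≤ ∑ j' : Fin M, periodizedPotential v L (x - Y j') :=
  calc min (v ‖x - Y j‖) K ≤ v ‖x - Y j‖ := min_le_left _ _
    _ ≤ periodizedPotential v L (x - Y j) := le_periodizedPotential v L _
    _ ≤ ∑ j' : Fin M, periodizedPotential v L (x - Y j') :=
        Finset.single_le_sum (f := fun j' => periodizedPotential v L (x - Y j'))
          (fun _ _ => zero_le) (Finset.mem_univ j)

/-- The quenched potential `V_Y(x) = ∑ⱼ v^per(x - Yⱼ)` is measurable. [folklore] -/
theorem measurable_quenched {v : ℝ → ℝ≥0∞} (hv : Measurable v) (L : ℝ) {M : ℕ} (Y : Config M) :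
    Measurable fun x : Space => ∑ j : Fin M, periodizedPotential v L (x - Y j) :=
  Finset.measurable_sum _ fun _ _ =>
    (measurable_periodizedPotential hv L).comp (measurable_id.sub measurable_const)

/-- **The local mass bound on an occupied sub-cell.** If the sub-cell `Q = ℓq + [0,ℓ)³` contains
the range ball of the scatterer `Yⱼ` and `K ≤ 2π²/(3ℓ²)`, then for every `C¹` function `f`,
`W₀(K) ∫_Q |f|² ≤ 4ℓ³ ∫_Q (|∇f|² + V_Y|f|²)`, `W₀(K) = ∫ min(v(|z|),K)dz`. [folklore] -/
theorem local_bound_occupied {k : ℕ} {ℓ : ℝ} (hℓ : 0 < ℓ) {v : ℝ → ℝ≥0∞} (hv : Measurable v)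
    {R₀ : ℝ} (hv0 : ∀ r, R₀ < r → v r = 0) (L : ℝ) {M : ℕ} (Y : Config M) {j : Fin M}
    {q : SubIdx k} (hj : closedBall (Y j) R₀ ⊆ subCell ℓ q) {K : ℝ≥0∞}
    (hK : K ≤ ENNReal.ofReal (2 * Real.pi ^ 2 / (3 * ℓ ^ 2))) {f : Space → ℂ}
    (hf : ContDiff ℝ 1 f) :
    (∫⁻ z : Space, min (v ‖z‖) K) * ∫⁻ x in subCell ℓ q, (‖f x‖₊ : ℝ≥0∞) ^ 2 ≤
      ENNReal.ofReal (4 * ℓ ^ 3) * ∫⁻ x in subCell ℓ q, (gradSqC f x +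
        (∑ j' : Fin M, periodizedPotential v L (x - Y j')) * (‖f x‖₊ : ℝ≥0∞) ^ 2) := by
  set w : Space → ℝ≥0∞ := fun x => min (v ‖x - Y j‖) K with hw
  have hwm : Measurable w := ((hv.comp measurable_norm).comp (measurable_id.sub measurable_const)).min
    measurable_const
  have hwK : ∀ x, w x ≤ K := fun x => min_le_right _ _
  calc (∫⁻ z : Space, min (v ‖z‖) K) * ∫⁻ x in subCell ℓ q, (‖f x‖₊ : ℝ≥0∞) ^ 2
      ≤ (∫⁻ x in subCell ℓ q, w x) * ∫⁻ x in subCell ℓ q, (‖f x‖₊ : ℝ≥0∞) ^ 2 :=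
        mul_le_mul_left (lintegral_min_le_setLIntegral hv0 K hj) _
    _ ≤ ENNReal.ofReal (4 * ℓ ^ 3) *
          ∫⁻ x in subCell ℓ q, (gradSqC f x + w x * (‖f x‖₊ : ℝ≥0∞) ^ 2) :=
        local_mass_bound hℓ hf _ hwm hwK hK
    _ ≤ ENNReal.ofReal (4 * ℓ ^ 3) * ∫⁻ x in subCell ℓ q, (gradSqC f x +
          (∑ j' : Fin M, periodizedPotential v L (x - Y j')) * (‖f x‖₊ : ℝ≥0∞) ^ 2) := by
        gcongr with x
        exact min_le_quenched v L K Y j x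

/-- **Good configurations are not bad** (deterministic half of `FrozenBathNoBEC`). On the torus of
side `L = kℓ` with scatterers `Y`, suppose the sub-cells `q ∈ O` each contain a scatterer with its
range ball, `#Oᶜ ≤ εk³/4`, `K ≤ 2π²/(3ℓ²)`, `0 < W₀(K) < ∞`, `32ℓ³η ≤ W₀(K)ε`, and the reference
energy `E₀` (the quenched ground-state energy) is `≤ η`. Then it is false that for every `δ > 0`
some one-body periodic trial state has quenched energy `≤ E₀ + δ` and constant-mode weight `> ε`:
at `δ = η` every such state has energy `≤ 2η`, hence weight `≤ ε` by `weight_le_of_good`.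
[folklore] -/
theorem not_bad_of_good {k : ℕ} {ℓ : ℝ} (hℓ : 0 < ℓ) (hk : 1 ≤ k) (hkℓ : (k : ℝ) * ℓ = L)
    {v : ℝ → ℝ≥0∞} (hv : Measurable v) {R₀ : ℝ} (hv0 : ∀ r, R₀ < r → v r = 0) {M : ℕ}
    (Y : Config M) (O : Finset (SubIdx k)) (hocc : ∀ q ∈ O, ∃ j, closedBall (Y j) R₀ ⊆ subCell ℓ q)
    {K : ℝ≥0∞} (hK : K ≤ ENNReal.ofReal (2 * Real.pi ^ 2 / (3 * ℓ ^ 2)))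
    (hW0 : ∫⁻ z : Space, min (v ‖z‖) K ≠ 0) (hWt : ∫⁻ z : Space, min (v ‖z‖) K ≠ ⊤)
    {ε η : ℝ} (hε : 0 ≤ ε) (hη : 0 < η)
    (hU : (((Finset.univ \ O).card : ℕ) : ℝ) ≤ ε * (k : ℝ) ^ 3 / 4)
    (hηε : ENNReal.ofReal (32 * ℓ ^ 3 * η) ≤ (∫⁻ z : Space, min (v ‖z‖) K) * ENNReal.ofReal ε)
    {E₀ : ℝ≥0∞} (hE₀ : E₀ ≤ ENNReal.ofReal η) :
    ¬ ∀ δ : ℝ≥0∞, 0 < δ → ∃ φ : PeriodicTrialState 1 L,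
        (∫⁻ X in cellN 1 L, kineticDensity φ.ψ X +
            (∑ j : Fin M, periodizedPotential v L (X 0 - Y j)) * (‖φ.ψ X‖₊ : ℝ≥0∞) ^ 2) ≤
              E₀ + δ ∧
          ENNReal.ofReal ε < condensateOccupation 1 L φ.ψ := by
  intro hbad
  have hkpos : (0 : ℝ) < k := by exact_mod_cast hk
  have hL : 0 < L := by rw [← hkℓ]; exact mul_pos hkpos hℓ
  obtain ⟨φ, hEφ, hocc_lt⟩ := hbad (ENNReal.ofReal η) (ENNReal.ofReal_pos.2 hη)
  set f : Space → ℂ := fun x => φ.ψ fun _ => x with hfdef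
  set V : Space → ℝ≥0∞ := fun x => ∑ j : Fin M, periodizedPotential v L (x - Y j) with hVdef
  have hf : ContDiff ℝ 1 f := contDiff_oneBody φ
  have hV : Measurable V := measurable_quenched hv L Y
  -- the quenched energy of `f` is at most `2η`
  have hE : ∫⁻ x in cell (k * ℓ), (gradSqC f x + V x * (‖f x‖₊ : ℝ≥0∞) ^ 2) ≤
      ENNReal.ofReal (2 * η) := by
    rw [hkℓ, ← lintegral_quenched_eq φ V]
    calc _ ≤ E₀ + ENNReal.ofReal η := hEφ
      _ ≤ ENNReal.ofReal η + ENNReal.ofReal η := by gcongr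
      _ = ENNReal.ofReal (2 * η) := by rw [← ENNReal.ofReal_add hη.le hη.le, two_mul]
  -- local bounds on the occupied cells
  have hO : ∀ q ∈ O, (∫⁻ z : Space, min (v ‖z‖) K) * ∫⁻ x in subCell ℓ q, (‖f x‖₊ : ℝ≥0∞) ^ 2 ≤
      ENNReal.ofReal (4 * ℓ ^ 3) *
        ∫⁻ x in subCell ℓ q, (gradSqC f x + V x * (‖f x‖₊ : ℝ≥0∞) ^ 2) := by
    intro q hq
    obtain ⟨j, hj⟩ := hocc q hq
    exact local_bound_occupied hℓ hv hv0 L Y hj hK hf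
  -- normalisation
  have hnorm : ∫⁻ x in cell (k * ℓ), (‖f x‖₊ : ℝ≥0∞) ^ 2 = 1 := by
    rw [hkℓ]
    exact lintegral_normSq_eq_one φ
  -- the weight is at most `ε`
  have hw := weight_le_of_good hℓ hk hf.continuous hV O hW0 hWt hε hO hE hU hηε hnorm
  rw [hkℓ, ← condensateOccupation_one_eq hL φ] at hw
  exact absurd (hocc_lt.trans_le hw) (lt_irrefl _)

end Summit.AtomisticToContinuum.BoseEinsteinCondensation.Theorems.FrozenBath

end
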